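import Mathlib.Probability.ProbabilityMassFunction.Constructions
import Literature.Computability.Cryptography.SamplingProblems
import Literature.Computability.Cryptography.StatisticalDistance
import HarnessLib

/-!
# Barrier catalogue `QuantumAdvantage` — uncorrected noise: noisy sampling devices are classically simulable, and noise-agnostic hardness proofs cannot reach the sampling regime

Topic `Literature/Barriers/QuantumAdvantage` (D-0021). Summit statement:
`QuantumAdvantage := ∃ L, L ∈ BQP ∧ L ∉ BPP`.

BARRIER: technique_class := (A) *scalable* quantum-advantage claims from sampling devices with a
  constant rate of uncorrected noise per gate/qubit (random circuit sampling, IQP, BosonSampling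
  without fault tolerance), argued through anti-concentration plus average-case hardness of the
  ideal output probabilities; and (B) the proof programme "average-case `#P`-hardness of output
  probabilities, made robust to additive error `2^{-n}/poly`, then Stockmeyer" insofar as its
  worst-to-average-case step is *noise-agnostic* (polynomial interpolation and every "convex"
  method) [cite: BoulandFeffermanLandauLiu2022, §1 and §3] [cite: AharonovEtAl2023, §1.2];
  blocks := (A): with independent depolarizing noise of any constant rate on each qubit at the end
  of an anti-concentrated IQP circuit, the noisy distribution is sampled classically to constant
  `ℓ₁` accuracy in polynomial time (`bremnerMontanaroShepherd2017_thm4`, typed below over the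
  tree's uniform IQP families) [cite: BremnerMontanaroShepherd2017, Thm 4]; for random circuits on
  any fixed architecture with Haar-random two-qubit gates, constant-rate depolarizing noise per
  qubit per layer and anti-concentration, a classical algorithm samples `ε`-close in total variation
  to the noisy output distribution with probability `1 − δ` over the circuit in time
  `poly(n, 1/ε, 1/δ)`, so "no statistical test … can distinguish" the device from it and "random
  circuit sampling cannot be the basis of a scalable experimental violation of the extended
  Church–Turing thesis" in that noise model [cite: AharonovEtAl2023, Thm 1 and Cor 1]; for
  BosonSampling with constant noise level the noisy `|Per X|²` is efficiently approximable
  classically and for noise `ω(1)/n` the noisy/noiseless correlation vanishes [cite: KalaiKindler2014, (abstract)];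
  (B): the output probabilities of noisy random circuits are within `2^{-O(m)}` (conjecturally
  `O(e^{-γ d n})`) of `2^{-n}`, so no statement "computing them to additive error `2^{-o(m)}` is
  hard" can be true, while polynomial interpolation provably transfers to noisy circuits (hardness
  to `2^{-O(m log m)}`, Thm 8); hence "any noise-agnostic proof technique cannot prove sufficient
  robustness to prove hardness of sampling in the low noise setting", which "rules out any convex
  method … including polynomial interpolation" [cite: BoulandFeffermanLandauLiu2022, §3 (Discussion: the noise barrier), Thm 7, Thm 8];
  earlier, assuming anti-concentration, Aaronson–Arkhipov's argument shows polynomial interpolation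
  cannot tolerate the error needed for hardness of approximate sampling [cite: BoulandFeffermanLandauLiu2022, §7 (limitations of polynomial interpolation)];
  and a depth barrier: a shallow 2D random family that is hard to simulate exactly is approximately
  simulable in linear time for all but a superpolynomially small fraction of instances, so any
  robust average-case hardness technique "must be sensitive to both depth and noise"
  [cite: NappEtAl2022, (abstract)] [cite: BoulandFeffermanLandauLiu2022, §3];
  because := noise damps high-degree Fourier (Pauli-path) components: for IQP with end-of-circuit
  depolarizing noise the noisy distribution is approximated by its low-degree Fourier truncation,
  computable term by term when `Σ p² ≤ α 2⁻ⁿ` [cite: BremnerMontanaroShepherd2017, §1 and Thm 4];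
  for random circuits the Pauli-path integral restricted to low Hamming weight has `2^{-Ω(ℓ)}` TV
  error on average by orthogonality plus anti-concentration, and the surviving paths are sparse and
  enumerable in `2^{O(ℓ)}` time [cite: AharonovEtAl2023, §1.1]; the noise barrier is the
  convexity of the set of low-degree polynomials/rational functions used as error-correcting codes
  in the reductions [cite: BoulandFeffermanLandauLiu2022, §2.1 and §3];
  evasions_known := fault tolerance (error-corrected devices leave the constant-uncorrected-noise
  regime; the barrier is explicitly about NISQ devices) [cite: BoulandFeffermanLandauLiu2022, §1];
  for IQP with end-of-circuit noise, classical error-correction inside the IQP framework restores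
  conditional hardness for every noise rate `ε < 1` [cite: BremnerMontanaroShepherd2017, Thm 5];
  random circuits of sub-logarithmic depth, which do not anti-concentrate, are outside the scope of
  the polynomial-time simulation [cite: AharonovEtAl2023, §1.3] — anti-concentration needs
  `Ω(n log n)` gates, i.e. `Ω(log n)` depth, and `O(n log n)` suffice in 1D and all-to-all
  architectures [cite: DalzellHunterJonesBrandao2022, (abstract)]; non-unital noise (e.g. amplitude
  damping) makes the output distribution never anti-concentrate at any depth, so neither the
  easiness proof of Aharonov et al. nor the anti-concentration-based hardness proofs apply
  [cite: FeffermanEtAl2023, (abstract)]; techniques for (B) must be "explicitly not resilient to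
  uncorrected noise" and depth-sensitive [cite: BoulandFeffermanLandauLiu2022, §3];
  status := theorem (Bremner–Montanaro–Shepherd Thm 4/5, Aharonov et al. Thm 1, Bouland et al.
  Thm 7/8, Kalai–Kindler, Napp et al., Dalzell et al., Fefferman et al. are theorems in print; the
  `2^{-O(m)}` convergence to uniform for realistic per-gate noise is stated as a conjecture, proved
  in a toy model [cite: BoulandFeffermanLandauLiu2022, §1]).

## Contents

* `biasedCoin η`, `flipBits η`, `SamplingProblem.withBitFlips` — independent bit-flip noise on the measured
  string (end-of-circuit single-qubit depolarizing noise at rate `ε` is bit-flip noise with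
  `η = ε/2` on each output bit).
* `collisionMass p N` — `Σ_{y ∈ {0,1}^N} p(y)²`, the anti-concentration functional
  ("`Σₓ pₓ² ≤ α 2⁻ⁿ`" in Bremner–Montanaro–Shepherd Thm 4; expected collision probability in
  Dalzell et al. and Aharonov et al. Def. 4).
* `bremnerMontanaroShepherd2017_thm4` — Theorem 4 for uniform families of the tree's IQP circuits
  (`IQPFamily`, diagonal gates `{Z, CZ, T}`), with the constants `α, ε, δ` fixed before the
  algorithm so that the running time `n^{O(log(α/δ)/ε)}` is polynomial.

## Design notes

* The tree's `IQPFamily.kernel` runs `H^{⊗N} D_{|x|} H^{⊗N}` on `|x⟩|0…0⟩`; since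
  `H^{⊗N}|x,0⟩ = Z^x H^{⊗N}|0⟩`, this is Theorem 4's `H^{⊗N} (D Z^x) H^{⊗N}|0⟩` with a poly-time
  computable diagonal, so the family form is an instance of the theorem (a special case: the
  theorem allows any poly-time computable diagonal `f`).
* Accuracy: the theorem's `ℓ₁` accuracy `δ` is `PMF.tvDist ≤ δ/2` (the tree's `tvDist` carries the
  factor `½`).
* Aharonov et al. Thm 1, Kalai–Kindler and Bouland et al. Thm 7/8 involve continuous gate ensembles,
  noise channels on density matrices and running times of algorithms with real-number inputs; they
  are cited in prose only (no faithful typing over the tree's pure-state `QCircuit` semantics).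

## References

* [BremnerMontanaroShepherd2017] M. J. Bremner, A. Montanaro, D. J. Shepherd, *Achieving quantum
  supremacy with sparse and noisy commuting quantum computations*, Quantum 1 (2017) 8
  (arXiv:1610.01808): §1, Thm 4, Thm 5. Read via `lit read paper:arxiv-1610.01808`.
* [AharonovEtAl2023] D. Aharonov, X. Gao, Z. Landau, Y. Liu, U. Vazirani, STOC 2023
  (arXiv:2211.03999): Thm 1, Cor 1, §1.1–1.3, Def. 4.
* [BoulandFeffermanLandauLiu2022] A. Bouland, B. Fefferman, Z. Landau, Y. Liu, *Noise and the
  frontier of quantum supremacy*, FOCS 2021 (arXiv:2102.01738): §1, §2.1, §3, Thm 7, Thm 8, §7.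
* [KalaiKindler2014] G. Kalai, G. Kindler, *Gaussian noise sensitivity and BosonSampling*,
  arXiv:1409.3093, abstract.
* [NappEtAl2022] J. Napp, R. La Placa, A. Dalzell, F. Brandão, A. Harrow, *Efficient classical
  simulation of random shallow 2D quantum circuits*, Phys. Rev. X 12 (2022) 021021
  (arXiv:2001.00021), abstract.
* [DalzellHunterJonesBrandao2022] A. Dalzell, N. Hunter-Jones, F. Brandão, *Random quantum circuits
  anticoncentrate in log depth*, PRX Quantum 3 (2022) 010333 (arXiv:2011.12277), abstract.
* [FeffermanEtAl2023] B. Fefferman, S. Ghosh, M. Gullans, K. Kuroiwa, K. Sharma, *Effect of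
  non-unital noise on random circuit sampling*, arXiv:2306.16659, abstract.
-/

noncomputable section

namespace Literature.Barriers.QuantumAdvantage

open scoped NNReal ENNReal
open _root_.Computability Literature.Computability.Complexity Literature.Computability.Cryptography

/-! ### End-of-circuit noise and anti-concentration -/

/-- The `η`-biased coin on `Bool` (`true`, i.e. "flip", with probability `η ≤ 1`).
[cite: BremnerMontanaroShepherd2017, §1 (noise model before Thm 4)] -/
def biasedCoin (η : ℝ≥0) (hη : η ≤ 1) : PMF Bool :=
  PMF.ofFintype (fun c => ((cond c η (1 - η) : ℝ≥0) : ℝ≥0∞)) (by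
    rw [Fintype.sum_bool, cond_true, cond_false, ← ENNReal.coe_add, add_tsub_cancel_of_le hη,
      ENNReal.coe_one])

/-- The biased coin flips with probability `η`. [cite: BremnerMontanaroShepherd2017, §1] -/
@[simp] theorem biasedCoin_apply_true (η : ℝ≥0) (hη : η ≤ 1) : biasedCoin η hη true = η := by
  simp [biasedCoin]

/-- Independent **bit-flip noise** with flip probability `η ≤ 1` on each bit of a string (the
effect on the measured string of single-qubit depolarizing noise `𝒟_ε(ρ) = (1−ε)ρ + ε I/2`
applied to every qubit before measurement, with `η = ε/2`).
[cite: BremnerMontanaroShepherd2017, §1 (noise model before Thm 4)] -/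
def flipBits (η : ℝ≥0) (hη : η ≤ 1) : List Bool → PMF (List Bool)
  | [] => PMF.pure []
  | b :: bs => (biasedCoin η hη).bind fun c => (flipBits η hη bs).map fun cs => (b ^^ c) :: cs

/-- On the empty string the noise does nothing. [cite: BremnerMontanaroShepherd2017, §1] -/
@[simp] theorem flipBits_nil (η : ℝ≥0) (hη : η ≤ 1) : flipBits η hη [] = PMF.pure [] := rfl

/-- The noisy version of a sampling problem: sample from `D_x`, then flip each output bit
independently with probability `η`. Deliberate dot-notation extension of
`Literature.Computability.Cryptography.SamplingProblem`. [cite: BremnerMontanaroShepherd2017, §1 (the distribution p̃)] -/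
def _root_.Literature.Computability.Cryptography.SamplingProblem.withBitFlips (D : SamplingProblem) (η : ℝ≥0)
    (hη : η ≤ 1) : SamplingProblem :=
  fun x => (D x).bind (flipBits η hη)

/-- The **collision mass** of a distribution on strings at length `N`: `Σ_{y ∈ {0,1}^N} p(y)²`
(the anti-concentration functional; `p` anti-concentrates at level `α` when this is
`≤ α · 2^{-N}`). [cite: BremnerMontanaroShepherd2017, Thm 4 (hypothesis Σₓ pₓ² ≤ α 2⁻ⁿ)] -/
def collisionMass (p : PMF (List Bool)) (N : ℕ) : ℝ :=
  ∑ y : List.Vector Bool N, (p y.toList).toReal ^ 2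

/-- The collision mass is nonnegative. [folklore] -/
theorem collisionMass_nonneg (p : PMF (List Bool)) (N : ℕ) : 0 ≤ collisionMass p N :=
  Finset.sum_nonneg fun _ _ => sq_nonneg _

/-! ### Bremner–Montanaro–Shepherd, Theorem 4 -/

/-- **Bremner–Montanaro–Shepherd 2017, Theorem 4** (for the tree's uniform IQP families). Source:
"Consider a unitary circuit `𝒞 = H^{⊗n} D H^{⊗n}` whose diagonal part `D` is defined by
`⟨x|D|x⟩ = f(x)` for some `f` computable in time `poly(n)`. Let the probability of receiving output
`x` after applying `𝒞` to `|0⟩^{⊗n}` be `pₓ`, and assume `Σₓ pₓ² ≤ α 2⁻ⁿ`. Further assume `𝒞`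
experiences independent depolarising noise on each qubit with rate `ε`. Then `T` samples can be
generated from a distribution which approximates the noisy output probability distribution up to
`δ` in `ℓ₁` norm, in time `n^{O(log(α/δ)/ε)} + T poly(n)`." Rendering: for a poly-time uniform
family of `{Z, CZ, T}`-diagonal IQP circuits (`N = |x| + ancillas |x|` wires on input `x`) whose
output distributions anti-concentrate at a fixed level `α`, and fixed noise `η = ε/2 ∈ (0, 1/2]` and
accuracy `δ > 0`, some probabilistic polynomial-time algorithm samples, on every input `x`, within
`ℓ₁` distance `δ` (total variation `δ/2`) of the noisy output distribution.
[cite: BremnerMontanaroShepherd2017, Thm 4] -/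
def bremnerMontanaroShepherd2017_thm4 : Prop :=
  ∀ (F : IQPFamily) (α δ : ℝ) (η : ℝ≥0) (hη : η ≤ 1), F.IsUniform → 0 < η → (η : ℝ) ≤ 1 / 2 →
    0 < δ →
    (∀ x : List Bool, collisionMass (F.kernel x) (x.length + F.ancillas x.length) ≤
        α / 2 ^ (x.length + F.ancillas x.length)) →
    ∃ A : RandAlg (List Bool) (List Bool), IsPPT A id ∧
      ∀ x : List Bool, (A.outputPMF id x).tvDist ((F.kernel.withBitFlips η hη) x) ≤ δ / 2

end Literature.Barriers.QuantumAdvantage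

end
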